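import Literature.MathematicalPhysics.QuantumFieldTheory.Balaban1983to89.B8Eq191FlatLettersRDTau
import Literature.MathematicalPhysics.QuantumFieldTheory.Balaban1983to89.B8Eq191FlatLettersCubeMember
import Literature.MathematicalPhysics.QuantumFieldTheory.Balaban1983to89.B8Thm32GBoundCubeMemberHolds
import Literature.MathematicalPhysics.QuantumFieldTheory.Balaban1983to89.T3ContinuumYM3Torus
import Literature.MathematicalPhysics.QuantumFieldTheory.Balaban1983to89.B8SpecialUnitaryTrace
import Literature.MathematicalPhysics.QuantumFieldTheory.Balaban1983to89.B10Eq29TubeLine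
import HarnessLib

/-!
# Route `UnitScaleTilt`, crux K1 child «MinimiserStabilityRegPr» (stmt-QuantumFields-19200), registered stub `stub_halvingStep` (v10 `BirthV10`), line H, ROAD γ —
# ★★ «(L-A) SLetτ-SUPPLY»: THE DISPLAYED SOCKET ROW `SLetτL` ∕ `SLetτAllL` ([Balaban1985BackgroundPropagators] Thm 3.1 ∕ (3.25) LETTERS AT THE FLAT BACKGROUND
# `U₀ := 1` on N05's Dirichlet cube member, WITH THE FIVE PRINTED BOUNDS (1.92) ∕ (1.98) ∕ (1.101) AND THE `τ`-LAWS) IS A THEOREM ON PRINT'S BIG-BLOCK SUB-LATTICE —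
# generic `𝔸`-valued form, every truncation `1 ≤ n′ ≤ k`, constants depending on `(d, L)` only.

Cell `ym3-torus` (HUMAN RULING D-0037: YM₃ on T³ is ladder rung R3 — NOT d = 4, NOT a mass gap, NOT the Clay problem), width seat `ym3-torus-px9` gen 5 (LEAD-H ★w5-19200 g7
H-NAMER WORD 4 (L-A) «SLetτ-SUPPLY» LOCATE; memo `LOCATE-SLETTAU-SUPPLY-px9g5.md` on HOME + 19200 evidence).  `--supports stmt-QuantumFields-19200 --as helper`; THEOREMS ONLY
(0 `def`, 0 `sorry`); count-neutral; nothing here claims `hT4TLγ`, `H42topCrossT`, `hSupUρ5`, the stub, the crux or the gap.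

WHAT IS PROVED (by-name composition of THREE landed Literature theorems of pub-ymgap's N05 flat line; ZERO new analysis):
* lit ✓`B8Thm32GBoundCubeMemberHolds.prop6_real123_printed` (dag-n05-c F8 + G3: the three REAL inequality families (1.101) ∕ (1.92)+Δ ∕ (1.98) for the explicit matrices
  `T⁻¹`, `T⁻¹T⁻¹Qᵀ(QT⁻¹T⁻¹Qᵀ)⁻¹`, `T⁻¹Qᵀ(QT⁻¹T⁻¹Qᵀ)⁻¹QT⁻¹` of the flat letters at the printed weights `wPrinted`, UNCONDITIONAL on print's p. 98 sub-lattice, every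
  truncation `1 ≤ n ≤ k`, constants `B_G, B′₀H > 0`, `B₂′, B_R ≥ 0` depending on `d, ℓ` only — underneath: [4] Thm 3.2 (3.48) 𝒢-bound `gBoundCubeMemberPrinted_of_one_le`)
* → lit ✓`B8Eq191FlatLettersRDTau.flatLettersRD_of_real_tau` (dag-n05-e F3: the complete 16-binder [4]-letters block of the JOIN at `U₀ = 1` on a finite Dirichlet region from the
  three real families, PLUS the three `τ`-rows — the letters are real kernels ⊗ id)
* on the cube member's tower geometry lit ✓`B8Eq191FlatLettersCubeMember.{cubeFam_zero_finite, cubeLamS_finite, cubeFam_subset_zero, tower_meets_cube, towers_disjoint_cube}` (n05-e g3).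
The composition is the one kernel-checked INSIDE lit ✓`B8Prop6CubeMemberFlatScalarGammaG.prop6_cubeMember_flat_of_real_γ_mem` (F4, :341–351) where the REAL block is a hypothesis;
here it is exported as a standalone statement with the REAL block discharged.
* §1 ★★ `sLetτAll_flat_cubeMember_printed (τ) (hd : 1 ≤ d) (hL : 2 ≤ L)` — `∃ B′₀H B₂′ B_G B_R ρ₀ M₀ N₀` (signs) `∀ η > 0, ∀ Mh ≥ 3, M₀ ≤ L·Mh → ∀ a M ρ k R` ⟨print's side
  conditions `Mh·L ∣ ρ`, `Mh·L ∣ M`, `R·Mh·L ≤ ρ`, `2L ≤ R`, `N₀ + 1 ≤ R·L·Mh`, `ρ₀ ≤ ρ`⟩ `→ ∀ n′, 1 ≤ n′ → n′ ≤ k →` the nineteen rows of the socket text `SLetτ` (lit `SockLettersRD`'s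
  body at `(U₀ := 1, n′)` + the three `τ`-rows) on `Ω := cubeFam false L a M ρ k`, `Λs := cubeLamS L a M ρ k n′`.

HONEST SCOPE.  By-name plumbing; the analysis is pub-ymgap's (dag-n05-c R23 programme: [B6] Prop. 2.3 random walk on the L0 multi-level box, kernel-checked there); the SIDE
CONDITIONS are print's p. 98 («M a multiple of R₁M₁ … □_j a sum of big blocks») — OFF the sub-lattice (in particular `ρ < L`) nothing is claimed and the tree has no supplier;
nothing of [B8] Prop. 3 ∕ Thm 4 ∕ Prop. 5, `hSupUρ5`, the stub or the crux is asserted; YM₃ on T³ = rung R3 — not d = 4, not Clay, no mass gap.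

References: T. Bałaban, CMP **99** (1985) 389–434 [Balaban1985BackgroundPropagators] (Thm 3.1 (3.47) p.398, Thm 3.2 (3.48) p.398, (3.23)–(3.25) p.394); CMP **99** (1985) 75–102
[Balaban1985RegularSpaces] ((1.91)–(1.92) p.91, (1.98) p.92, (1.101) p.93, p.98, p.76); CMP **96** (1984) 223–250 [Balaban1984PropagatorsII] (Prop. 2.3 p.238, p.235).
-/

set_option autoImplicit false

noncomputable section

namespace Summit.QuantumFields.YangMills.Theorems.HalvingSLetTauFlatCubeMember

open Literature.MathematicalPhysics.QuantumFieldTheory.Balaban1983to89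
open B7Prop1Explicit (e)
open B7Prop1Explicit renaming Site → LSite
open B7Eq78Linearization (QprimeIter zdBlocking)
open B8Ineq132 (covDerivFwd)
open B8Eq119TwistedAxial (bgT)
open B8Eq138LandauZd (covLap QT)
open B8Eq140Level (SideTouches)
open B8Eq1117Concrete (XSpace)
open B8Prop5ContractionKLevel (Bd2)
open B8LambdaSpaceKLevel (wt)
open B8Eq131CubesAdmissible (cubeFam)
open B8CubeMemberZd (cubeLamS)
open B8Eq1101CubeMemberWeights (wPrinted wPrinted_facts)
open B8Eq191FlatLettersDirichlet (exists_towerFinset)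
open B8Eq191FlatLettersCubeMember (cubeLamS_finite cubeFam_zero_finite cubeFam_subset_zero tower_meets_cube towers_disjoint_cube)
open B8Eq191FlatLettersRDTau (flatLettersRD_of_real_tau)
open B8Thm32GBoundCubeMemberHolds (prop6_real123_printed)
open Literature.MathematicalPhysics.QuantumLattice (blockMap)

/-! ## §1 ★★ The [4]-letters block with bounds and `τ`-laws at the flat cube member, every truncation, on print's sub-lattice — generic `𝔸` -/

section Generic

variable {𝔸 : Type*} [CStarAlgebra 𝔸]

open Classical in
/-- ★★ **«SLetτ-SUPPLY», GENERIC FORM.**  For a C⋆-algebra `𝔸`, a continuous ℂ-linear functional `τ`, a dimension `d ≥ 1` and a block size `L ≥ 2` there are constants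
`B′₀H > 0`, `B₂′, B_G, B_R ≥ 0` and thresholds `ρ₀, M₀ > 0`, `N₀` (all depending on `d, L` only) such that: for every `η > 0`, every big-block size `Mh ≥ 3` with `M₀ ≤ L·Mh`,
every cube datum `(a, M, ρ, k)` of N05's Dirichlet cube member ON PRINT'S p. 98 SUB-LATTICE (`Mh·L ∣ ρ`, `Mh·L ∣ M`, `R·(Mh·L) ≤ ρ` with `2L ≤ R`, `N₀ + 1 ≤ R·(L·Mh)`, `ρ₀ ≤ ρ`)
and every truncation `1 ≤ n′ ≤ k`, the seven [4]-letters `g Δ q qs Aw c H′` at the flat background `U₀ := 1` on `Ω := cubeFam false L a M ρ k`, structure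
`Λs := cubeLamS L a M ρ k n′`, EXIST with the eleven algebraic laws, the FIVE PRINTED BOUNDS ((1.92) `hH0 hH1 hH2`, (1.101) `hG`, (1.98) `hRbd`) and the three `τ`-laws —
i.e. the body of lit `SockLettersRD` at `(U₀ := 1, n′)` plus lit `LettersTau`'s rows, = the cell's socket text `SLetτ` ∕ `SLetτAll`.  Proof: lit ✓`prop6_real123_printed`
(REAL-1∕2∕3, unconditional) fed into lit ✓`flatLettersRD_of_real_tau` on the cube member's tower geometry (lit ✓`tower_meets_cube` ∕ ✓`towers_disjoint_cube`).
[cite: Balaban1985BackgroundPropagators, Thm 3.1 (3.47) p.398, Thm 3.2 (3.48) p.398, (3.23)-(3.25) p.394; Balaban1985RegularSpaces, (1.91)-(1.92) p.91, (1.98) p.92, (1.101) p.93, p.98, p.76; Balaban1984PropagatorsII, Prop. 2.3 p.238] -/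
theorem sLetτAll_flat_cubeMember_printed (τ : 𝔸 →L[ℂ] ℂ) {d : ℕ} (hd : 1 ≤ d) {L : ℕ} (hL : 2 ≤ L) :
    ∃ B₀'H B₂' BG BR ρ₀ M₀ : ℝ, ∃ N₀ : ℕ, 0 < B₀'H ∧ 0 ≤ B₂' ∧ 0 ≤ BG ∧ 0 ≤ BR ∧ 0 < M₀ ∧
    ∀ (η : ℝ), 0 < η → ∀ (Mh : ℕ), 3 ≤ Mh → M₀ ≤ (L : ℝ) * Mh →
    ∀ (a : LSite d) (M ρ k R : ℕ), Mh * L ∣ ρ → Mh * L ∣ M → R * (Mh * L) ≤ ρ → 2 * L ≤ R → N₀ + 1 ≤ R * (L * Mh) → ρ₀ ≤ (ρ : ℝ) →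
    ∀ (n' : ℕ), 1 ≤ n' → n' ≤ k →
      ∃ (g Δ : (LSite d → 𝔸) →ₗ[ℂ] (LSite d → 𝔸)) (q : (LSite d → 𝔸) →ₗ[ℂ] (ℕ → LSite d → 𝔸))
        (qs : (ℕ → LSite d → 𝔸) →ₗ[ℂ] (LSite d → 𝔸)) (Aw c : (ℕ → LSite d → 𝔸) →ₗ[ℂ] (ℕ → LSite d → 𝔸))
        (H' : XSpace d n' 𝔸 →ₗ[ℂ] (LSite d → 𝔸)),
      (∀ x, ∀ y ∈ cubeFam false L a M ρ k 0, (Δ (g x) + qs (Aw (q (g x)))) y = x y) ∧ (∀ f, q (g (g (qs (c (q f))))) = q f) ∧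
      (∀ (f : LSite d → 𝔸), ∀ x ∈ cubeFam false L a M ρ k 0, Δ f x = covLap η (1 : LSite d → Fin d → 𝔸ˣ) ((cubeFam false L a M ρ k 0).indicator f) x) ∧
      (∀ (μ : ℕ → LSite d → 𝔸), ∀ x ∈ cubeFam false L a M ρ k 0, qs μ x = QT L n' (cubeLamS L a M ρ k n') (1 : LSite d → Fin d → 𝔸ˣ) μ x) ∧
      (∀ (f : LSite d → 𝔸) (j : ℕ), j ≤ n' → ∀ y ∈ cubeLamS L a M ρ k n' j, q f j y = QprimeIter (zdBlocking d L) (bgT L (1 : LSite d → Fin d → 𝔸ˣ)) j f y) ∧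
      (∀ (X : XSpace d n' 𝔸) (x : LSite d), ‖H' X x‖ ≤ B₀'H * ‖X‖) ∧
      (∀ j, j ≤ n' → ∀ (X : XSpace d n' 𝔸), ∀ p ∈ {b : LSite d × Fin d | SideTouches (cubeFam false L a M ρ k j) b.1 b.2},
        wt L η j * ‖covDerivFwd η (1 : LSite d → Fin d → 𝔸ˣ) p.2 (H' X) p.1‖ ≤ B₀'H * ‖X‖) ∧
      (∀ X : XSpace d n' 𝔸, Bd2 L η n' (cubeFam false L a M ρ k) (covLap η (1 : LSite d → Fin d → 𝔸ˣ) (H' X)) (B₂' * ‖X‖)) ∧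
      (∀ (X : XSpace d n' 𝔸) (x : LSite d), x ∉ cubeFam false L a M ρ k 0 → H' X x = 0) ∧
      (∀ X Y : XSpace d n' 𝔸, (∀ p, Y p = -star (X p)) → ∀ x, H' Y x = -star (H' X x)) ∧
      (∀ (Y : XSpace d n' 𝔸) (j : ℕ) (hj : j ≤ n') (y : LSite d), y ∈ cubeLamS L a M ρ k n' j →
        QprimeIter (zdBlocking d L) (bgT L (1 : LSite d → Fin d → 𝔸ˣ)) j (H' Y) y = Y (⟨j, Nat.lt_succ_of_le hj⟩, y)) ∧
      (∀ (f : LSite d → 𝔸) (r : ℝ), 0 ≤ r → Bd2 L η n' (cubeFam false L a M ρ k) f r →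
        (∀ x, ‖g f x‖ ≤ BG * r) ∧ ∀ j, j ≤ n' → ∀ p ∈ {b : LSite d × Fin d | SideTouches (cubeFam false L a M ρ k j) b.1 b.2},
          wt L η j * ‖covDerivFwd η (1 : LSite d → Fin d → 𝔸ˣ) p.2 (g f) p.1‖ ≤ BG * r) ∧
      (∀ (f : LSite d → 𝔸) (x : LSite d), x ∉ cubeFam false L a M ρ k 0 → g f x = 0) ∧
      (∀ f : LSite d → 𝔸, (∀ j, j ≤ n' → ∀ x ∈ cubeFam false L a M ρ k j, IsSelfAdjoint (f x)) → ∀ x, IsSelfAdjoint (g f x)) ∧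
      (∀ (f : LSite d → 𝔸) (r : ℝ), 0 ≤ r → Bd2 L η n' (cubeFam false L a M ρ k) f r → Bd2 L η n' (cubeFam false L a M ρ k) (f - g (qs (c (q (g f))))) (BR * r)) ∧
      (∀ f : LSite d → 𝔸, (∀ j, j ≤ n' → ∀ x ∈ cubeFam false L a M ρ k j, IsSelfAdjoint (f x)) →
        ∀ j, j ≤ n' → ∀ x ∈ cubeFam false L a M ρ k j, IsSelfAdjoint ((f - g (qs (c (q (g f))))) x)) ∧
      (∀ X : XSpace d n' 𝔸, (∀ p, τ (X p) = 0) → ∀ x, τ (H' X x) = 0) ∧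
      (∀ f : LSite d → 𝔸, (∀ j, j ≤ n' → ∀ x ∈ cubeFam false L a M ρ k j, τ (f x) = 0) → ∀ x, τ (g f x) = 0) ∧
      (∀ f : LSite d → 𝔸, (∀ j, j ≤ n' → ∀ x ∈ cubeFam false L a M ρ k j, τ (f x) = 0) →
        ∀ j, j ≤ n' → ∀ x ∈ cubeFam false L a M ρ k j, τ ((f - g (qs (c (q (g f))))) x) = 0) := by
  -- write `d = d' + 1`, `L = ℓ + 1` (dag-n05-c's convention)
  obtain ⟨d', rfl⟩ : ∃ d', d = d' + 1 := ⟨d - 1, by omega⟩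
  obtain ⟨ℓ, rfl⟩ : ∃ ℓ, L = ℓ + 1 := ⟨L - 1, by omega⟩
  have hℓ : 1 ≤ ℓ := by omega
  -- dag-n05-c's F8 + G3: the three REAL families at the printed weights, unconditional, constants depending on `d, ℓ`
  obtain ⟨BG, B₀'H, B₂', BR, ρ₀, M₀, N₀, hBG, hB₀'H, hB₂', hBR, hM₀, -, F⟩ := prop6_real123_printed d' ℓ hℓ
  refine ⟨B₀'H, B₂', BG, BR, ρ₀, M₀, N₀, hB₀'H, hB₂', hBG.le, hBR, hM₀, ?_⟩
  intro η hη Mh hMh hM0 a M ρ k R hρd hMd hR hR2 hRN hρ0 n' hn hnk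
  have hL1 : 1 ≤ ℓ + 1 := by omega
  -- `ρ ≥ R·Mh·L ≥ 2L·3·L > L > 0`
  have hRML : (ℓ + 1) ≤ R * (Mh * (ℓ + 1)) := by
    calc (ℓ + 1) = 1 * (1 * (ℓ + 1)) := by ring
      _ ≤ R * (Mh * (ℓ + 1)) := Nat.mul_le_mul (by omega) (Nat.mul_le_mul_right _ (by omega))
  have hρL : ℓ + 1 ≤ ρ := hRML.trans hR
  have hρpos : 0 < ρ := by omega
  have hM0' : M₀ ≤ ((ℓ : ℝ) + 1) * Mh := by
    have : ((ℓ + 1 : ℕ) : ℝ) = (ℓ : ℝ) + 1 := by push_cast; ring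
    rw [← this]; exact hM0
  -- the finite region `□₀` and the tower index set `𝔅` at truncation `n′`
  obtain ⟨S, hS⟩ : ∃ S : Finset (LSite (d' + 1)), ∀ x, x ∈ S ↔ x ∈ cubeFam false (ℓ + 1) a M ρ k 0 :=
    ⟨(cubeFam_zero_finite (ℓ + 1) a M ρ k).toFinset, fun x => Set.Finite.mem_toFinset _⟩
  obtain ⟨B, hB'⟩ := exists_towerFinset n' (cubeLamS (ℓ + 1) a M ρ k n') (fun j _ => cubeLamS_finite (ℓ + 1) a M ρ k n' j)
  -- REAL-1 ∕ REAL-2 ∕ REAL-3 at this datum and truncation, for the explicit matrices `T`, `Q` at `w := wPrinted`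
  obtain ⟨rG, rH, rR⟩ := F η hη Mh hMh hM0' a M ρ k n' R hn hnk hρd hMd hρpos hR hR2 hRN hρ0 S hS B hB' _ (fun _ _ => rfl) _ rfl _ rfl
  -- the letters with the eleven laws, the five bounds and the three `τ`-laws (n05-e F3 on g3's cube geometry)
  exact flatLettersRD_of_real_tau (𝔸 := 𝔸) τ (by omega) hη hL1 n' (cubeFam false (ℓ + 1) a M ρ k)
    (fun j _ => cubeFam_subset_zero hL1 a M hρL k j) (cubeLamS (ℓ + 1) a M ρ k n') (wPrinted d' ℓ η)
    (fun j => ((wPrinted_facts d' hℓ hη).1 j).le) S hS (tower_meets_cube hL1 a M hρL hnk) (towers_disjoint_cube hL1 a M hρL hnk) B hB' _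
    (fun _ _ => rfl) _ rfl _ rfl rG rH rR

end Generic

/-! ## §2 ★★ The T³ reading: the socket rows `SLetτAllL` ∕ `SLetτL` at `𝔸 := M₂(ℂ)`, `τ := tr`, in the H-lane's `(sx, ρ₅)` letters -/

section T3

open scoped Matrix.Norms.L2Operator
open Literature.MathematicalPhysics.QuantumFieldTheory.Balaban1983to89.T3ContinuumYM3Torus
open B8SpecialUnitaryTrace (trCLM)

/-- Threshold bookkeeping: for `L ≥ 2` and reals `M₀`, there is an exponent `s` with `3 ≤ L ^ s` and `M₀ ≤ L·L ^ s` (take `s := max 2 ⌈M₀⌉₊`, `s < 2 ^ s ≤ L ^ s`). [folklore] -/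
theorem exists_exponent_above (L : ℕ) (hL : 2 ≤ L) (M₀ : ℝ) : ∃ s : ℕ, 3 ≤ L ^ s ∧ M₀ ≤ (L : ℝ) * ((L ^ s : ℕ) : ℝ) := by
  refine ⟨max 2 ⌈M₀⌉₊, ?_, ?_⟩
  · calc 3 ≤ 2 ^ 2 := by norm_num
      _ ≤ 2 ^ max 2 ⌈M₀⌉₊ := Nat.pow_le_pow_right (by norm_num) (le_max_left _ _)
      _ ≤ L ^ max 2 ⌈M₀⌉₊ := Nat.pow_le_pow_left hL _
  · have h1 : ⌈M₀⌉₊ ≤ L ^ max 2 ⌈M₀⌉₊ :=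
      calc ⌈M₀⌉₊ ≤ max 2 ⌈M₀⌉₊ := le_max_right _ _
        _ ≤ 2 ^ max 2 ⌈M₀⌉₊ := Nat.lt_two_pow_self.le
        _ ≤ L ^ max 2 ⌈M₀⌉₊ := Nat.pow_le_pow_left hL _
    have h2 : (⌈M₀⌉₊ : ℝ) ≤ ((L ^ max 2 ⌈M₀⌉₊ : ℕ) : ℝ) := by exact_mod_cast h1
    have h3 : ((L ^ max 2 ⌈M₀⌉₊ : ℕ) : ℝ) ≤ (L : ℝ) * ((L ^ max 2 ⌈M₀⌉₊ : ℕ) : ℝ) :=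
      le_mul_of_one_le_left (by positivity) (by exact_mod_cast (show 1 ≤ L by omega))
    exact (Nat.le_ceil M₀).trans (h2.trans h3)

open Classical in
/-- ★★ **«(L-A) SLetτ-SUPPLY» — THE ALL-TRUNCATIONS SOCKET ROW `SLetτAllL` IS A THEOREM ON PRINT'S SUB-LATTICE.**  For every block size `L > 1` there are constants
`B′₀H > 0`, `B₂′, B_G, B_R ≥ 0` and sub-lattice letters `(sx, ρ₅)` (all depending on `L` only) such that for every member `F` (`F.L = L`), every `n < K`, every cube datum
`(a, M′, ρ′)` with `L^{sx+1} ∣ M′`, `L^{sx+1} ∣ ρ′`, `ρ₅ ≤ ρ′`, and every truncation `1 ≤ n′ ≤ K − n`, the [4]-letters package of the socket (lit `SockLettersRD`'s body at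
`(U₀ := 1, n′)` + the three `τ := tr` rows — the binder `SLetτAll` of ✓`HalvingHSiteT4OfLeafSockets.hT4T_of_leafSockets` :114–150 VERBATIM) holds on `cubeFam false (F.P K).L a M′ ρ′ (K − n)`,
`cubeLamS … (K − n) n′`.  §1 at `𝔸 := M₂(ℂ)` (structure `B10Eq29TubeLine.cstarAlgebraMatrix 2`), `τ := trCLM (Fin 2)`, `d := 3`, `Mh := L^{sx}`, `R := max (2L) (N₀ + 1)`.
[cite: Balaban1985BackgroundPropagators, Thm 3.1 (3.47) p.398, Thm 3.2 (3.48) p.398, (3.25) p.394; Balaban1985RegularSpaces, (1.91)-(1.92) p.91, (1.98) p.92, (1.101) p.93, p.98] -/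
theorem SLetτAllL_holds_member (L : ℕ) (hL : 1 < L) :
    ∃ (B₀'H B₂' BG BR : ℝ) (sx ρ₅ : ℕ), 0 < B₀'H ∧ 0 ≤ B₂' ∧ 0 ≤ BG ∧ 0 ≤ BR ∧
    ∀ (F : T3Family), F.L = L → ∀ (n K : ℕ), n < K → ∀ (a : LSite (F.P K).d) (M' ρ' : ℕ),
      L ^ (sx + 1) ∣ M' → L ^ (sx + 1) ∣ ρ' → ρ₅ ≤ ρ' → ∀ (n' : ℕ), 1 ≤ n' → n' ≤ K - n →
      ∃ (g Δ : (LSite (F.P K).d → Matrix (Fin 2) (Fin 2) ℂ) →ₗ[ℂ] (LSite (F.P K).d → Matrix (Fin 2) (Fin 2) ℂ))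
        (q : (LSite (F.P K).d → Matrix (Fin 2) (Fin 2) ℂ) →ₗ[ℂ] (ℕ → LSite (F.P K).d → Matrix (Fin 2) (Fin 2) ℂ))
        (qs : (ℕ → LSite (F.P K).d → Matrix (Fin 2) (Fin 2) ℂ) →ₗ[ℂ] (LSite (F.P K).d → Matrix (Fin 2) (Fin 2) ℂ))
        (Aw c : (ℕ → LSite (F.P K).d → Matrix (Fin 2) (Fin 2) ℂ) →ₗ[ℂ] (ℕ → LSite (F.P K).d → Matrix (Fin 2) (Fin 2) ℂ))
        (H' : XSpace (F.P K).d n' (Matrix (Fin 2) (Fin 2) ℂ) →ₗ[ℂ] (LSite (F.P K).d → Matrix (Fin 2) (Fin 2) ℂ)),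
      (∀ x, ∀ y ∈ cubeFam false (F.P K).L a M' ρ' (K - n) 0, (Δ (g x) + qs (Aw (q (g x)))) y = x y) ∧ (∀ f, q (g (g (qs (c (q f))))) = q f) ∧
      (∀ (f : LSite (F.P K).d → Matrix (Fin 2) (Fin 2) ℂ), ∀ x ∈ cubeFam false (F.P K).L a M' ρ' (K - n) 0,
        Δ f x = covLap (((F.L : ℝ)⁻¹) ^ (K - n)) (1 : LSite (F.P K).d → Fin (F.P K).d → (Matrix (Fin 2) (Fin 2) ℂ)ˣ) ((cubeFam false (F.P K).L a M' ρ' (K - n) 0).indicator f) x) ∧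
      (∀ (μ : ℕ → LSite (F.P K).d → Matrix (Fin 2) (Fin 2) ℂ), ∀ x ∈ cubeFam false (F.P K).L a M' ρ' (K - n) 0,
        qs μ x = QT (F.P K).L n' (cubeLamS (F.P K).L a M' ρ' (K - n) n') (1 : LSite (F.P K).d → Fin (F.P K).d → (Matrix (Fin 2) (Fin 2) ℂ)ˣ) μ x) ∧
      (∀ (f : LSite (F.P K).d → Matrix (Fin 2) (Fin 2) ℂ) (j : ℕ), j ≤ n' → ∀ y ∈ cubeLamS (F.P K).L a M' ρ' (K - n) n' j,
        q f j y = QprimeIter (zdBlocking (F.P K).d (F.P K).L) (bgT (F.P K).L (1 : LSite (F.P K).d → Fin (F.P K).d → (Matrix (Fin 2) (Fin 2) ℂ)ˣ)) j f y) ∧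
      (∀ (X : XSpace (F.P K).d n' (Matrix (Fin 2) (Fin 2) ℂ)) (x : LSite (F.P K).d), ‖H' X x‖ ≤ B₀'H * ‖X‖) ∧
      (∀ j, j ≤ n' → ∀ (X : XSpace (F.P K).d n' (Matrix (Fin 2) (Fin 2) ℂ)), ∀ p ∈ {b : LSite (F.P K).d × Fin (F.P K).d | SideTouches (cubeFam false (F.P K).L a M' ρ' (K - n) j) b.1 b.2},
        wt (F.P K).L (((F.L : ℝ)⁻¹) ^ (K - n)) j * ‖covDerivFwd (((F.L : ℝ)⁻¹) ^ (K - n)) (1 : LSite (F.P K).d → Fin (F.P K).d → (Matrix (Fin 2) (Fin 2) ℂ)ˣ) p.2 (H' X) p.1‖ ≤ B₀'H * ‖X‖) ∧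
      (∀ X : XSpace (F.P K).d n' (Matrix (Fin 2) (Fin 2) ℂ), Bd2 (F.P K).L (((F.L : ℝ)⁻¹) ^ (K - n)) n' (cubeFam false (F.P K).L a M' ρ' (K - n))
        (covLap (((F.L : ℝ)⁻¹) ^ (K - n)) (1 : LSite (F.P K).d → Fin (F.P K).d → (Matrix (Fin 2) (Fin 2) ℂ)ˣ) (H' X)) (B₂' * ‖X‖)) ∧
      (∀ (X : XSpace (F.P K).d n' (Matrix (Fin 2) (Fin 2) ℂ)) (x : LSite (F.P K).d), x ∉ cubeFam false (F.P K).L a M' ρ' (K - n) 0 → H' X x = 0) ∧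
      (∀ X Y : XSpace (F.P K).d n' (Matrix (Fin 2) (Fin 2) ℂ), (∀ p, Y p = -star (X p)) → ∀ x, H' Y x = -star (H' X x)) ∧
      (∀ (Y : XSpace (F.P K).d n' (Matrix (Fin 2) (Fin 2) ℂ)) (j : ℕ) (hj : j ≤ n') (y : LSite (F.P K).d), y ∈ cubeLamS (F.P K).L a M' ρ' (K - n) n' j →
        QprimeIter (zdBlocking (F.P K).d (F.P K).L) (bgT (F.P K).L (1 : LSite (F.P K).d → Fin (F.P K).d → (Matrix (Fin 2) (Fin 2) ℂ)ˣ)) j (H' Y) y = Y (⟨j, Nat.lt_succ_of_le hj⟩, y)) ∧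
      (∀ (f : LSite (F.P K).d → Matrix (Fin 2) (Fin 2) ℂ) (r : ℝ), 0 ≤ r → Bd2 (F.P K).L (((F.L : ℝ)⁻¹) ^ (K - n)) n' (cubeFam false (F.P K).L a M' ρ' (K - n)) f r →
        (∀ x, ‖g f x‖ ≤ BG * r) ∧ ∀ j, j ≤ n' → ∀ p ∈ {b : LSite (F.P K).d × Fin (F.P K).d | SideTouches (cubeFam false (F.P K).L a M' ρ' (K - n) j) b.1 b.2},
          wt (F.P K).L (((F.L : ℝ)⁻¹) ^ (K - n)) j * ‖covDerivFwd (((F.L : ℝ)⁻¹) ^ (K - n)) (1 : LSite (F.P K).d → Fin (F.P K).d → (Matrix (Fin 2) (Fin 2) ℂ)ˣ) p.2 (g f) p.1‖ ≤ BG * r) ∧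
      (∀ (f : LSite (F.P K).d → Matrix (Fin 2) (Fin 2) ℂ) (x : LSite (F.P K).d), x ∉ cubeFam false (F.P K).L a M' ρ' (K - n) 0 → g f x = 0) ∧
      (∀ f : LSite (F.P K).d → Matrix (Fin 2) (Fin 2) ℂ, (∀ j, j ≤ n' → ∀ x ∈ cubeFam false (F.P K).L a M' ρ' (K - n) j, IsSelfAdjoint (f x)) → ∀ x, IsSelfAdjoint (g f x)) ∧
      (∀ (f : LSite (F.P K).d → Matrix (Fin 2) (Fin 2) ℂ) (r : ℝ), 0 ≤ r → Bd2 (F.P K).L (((F.L : ℝ)⁻¹) ^ (K - n)) n' (cubeFam false (F.P K).L a M' ρ' (K - n)) f r →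
        Bd2 (F.P K).L (((F.L : ℝ)⁻¹) ^ (K - n)) n' (cubeFam false (F.P K).L a M' ρ' (K - n)) (f - g (qs (c (q (g f))))) (BR * r)) ∧
      (∀ f : LSite (F.P K).d → Matrix (Fin 2) (Fin 2) ℂ, (∀ j, j ≤ n' → ∀ x ∈ cubeFam false (F.P K).L a M' ρ' (K - n) j, IsSelfAdjoint (f x)) →
        ∀ j, j ≤ n' → ∀ x ∈ cubeFam false (F.P K).L a M' ρ' (K - n) j, IsSelfAdjoint ((f - g (qs (c (q (g f))))) x)) ∧
      (∀ X : XSpace (F.P K).d n' (Matrix (Fin 2) (Fin 2) ℂ), (∀ p, trCLM (Fin 2) (X p) = 0) → ∀ x, trCLM (Fin 2) (H' X x) = 0) ∧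
      (∀ f : LSite (F.P K).d → Matrix (Fin 2) (Fin 2) ℂ, (∀ j, j ≤ n' → ∀ x ∈ cubeFam false (F.P K).L a M' ρ' (K - n) j, trCLM (Fin 2) (f x) = 0) → ∀ x, trCLM (Fin 2) (g f x) = 0) ∧
      (∀ f : LSite (F.P K).d → Matrix (Fin 2) (Fin 2) ℂ, (∀ j, j ≤ n' → ∀ x ∈ cubeFam false (F.P K).L a M' ρ' (K - n) j, trCLM (Fin 2) (f x) = 0) →
        ∀ j, j ≤ n' → ∀ x ∈ cubeFam false (F.P K).L a M' ρ' (K - n) j, trCLM (Fin 2) ((f - g (qs (c (q (g f))))) x) = 0) := by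
  letI : CStarAlgebra (Matrix (Fin 2) (Fin 2) ℂ) := B10Eq29TubeLine.cstarAlgebraMatrix 2
  have hL2 : 2 ≤ L := hL
  -- §1 at `M₂(ℂ)`, `τ := tr`, `d := 3`, block size `L`: constants and thresholds depending on `L` only
  obtain ⟨B₀'H, B₂', BG, BR, ρ₀, M₀, N₀, hB₀'H, hB₂', hBG, hBR, -, H⟩ :=
    sLetτAll_flat_cubeMember_printed (𝔸 := Matrix (Fin 2) (Fin 2) ℂ) (trCLM (Fin 2)) (d := 3) (by norm_num) hL2
  -- the sub-lattice letters: `Mh := L ^ s`, `R := max (2L) (N₀ + 1)`, `ρ₅ := max ⌈ρ₀⌉₊ (R·L^{s+1})`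
  obtain ⟨s, hs3, hsM⟩ := exists_exponent_above L hL2 M₀
  refine ⟨B₀'H, B₂', BG, BR, s, max ⌈ρ₀⌉₊ (max (2 * L) (N₀ + 1) * L ^ (s + 1)), hB₀'H, hB₂', hBG, hBR, ?_⟩
  intro F hF n K hnK a M' ρ' hdM hdρ hρ₅ n' hn hnk
  subst hF
  have hpow : F.L ^ s * F.L = F.L ^ (s + 1) := (pow_succ _ _).symm
  have hdρ' : F.L ^ s * F.L ∣ ρ' := hpow ▸ hdρ
  have hdM' : F.L ^ s * F.L ∣ M' := hpow ▸ hdM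
  have hRρ : max (2 * F.L) (N₀ + 1) * (F.L ^ s * F.L) ≤ ρ' := by rw [hpow]; exact (le_max_right _ _).trans hρ₅
  have hR2 : 2 * F.L ≤ max (2 * F.L) (N₀ + 1) := le_max_left _ _
  have hRN : N₀ + 1 ≤ max (2 * F.L) (N₀ + 1) * (F.L * F.L ^ s) :=
    (le_max_right _ _).trans (Nat.le_mul_of_pos_right _ (Nat.mul_pos (by omega) (by omega)))
  have hρ0 : ρ₀ ≤ (ρ' : ℝ) := (Nat.le_ceil ρ₀).trans (by exact_mod_cast (le_max_left _ _).trans hρ₅)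
  have hη : 0 < ((F.L : ℝ)⁻¹) ^ (K - n) := by
    have hL0 : (0 : ℝ) < F.L := by exact_mod_cast (show 0 < F.L by omega)
    positivity
  exact H _ hη (F.L ^ s) hs3 hsM a M' ρ' (K - n) (max (2 * F.L) (N₀ + 1)) hdρ' hdM' hRρ hR2 hRN hρ0 n' hn hnk

open Classical in
/-- ★★ **«(L-A) SLetτ-SUPPLY» — THE DISPLAYED TOP-TRUNCATION SOCKET ROW `SLetτL` IS A THEOREM ON PRINT'S SUB-LATTICE.**  Same constants and letters as
`SLetτAllL_holds_member`, at the top truncation `n′ := K − n` (`1 ≤ K − n` from `n < K`); the conclusion is the `SLetτL` conjunct of ✓`HalvingHSupURho4OfSocketsGamma.hSupUρ4_of_socketsγ`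
:107–131 (= the (S1)∕(S2) socket row of LEAD-H ★w5-19200 g7 WORD 6, «`SLetτL` untouched») VERBATIM, under the member's `∀ a ρ′` WITH the two sub-lattice antecedents
`L^{sx+1} ∣ ρ′`, `ρ₅ ≤ ρ′` (and `L^{sx+1} ∣ M′` outside) — which the packs discharge at `ρ′ := ρ + M + L + S` from the ρ5∕ρ6 member prefix.
[cite: Balaban1985BackgroundPropagators, Thm 3.1 (3.47) p.398, Thm 3.2 (3.48) p.398, (3.25) p.394; Balaban1985RegularSpaces, (1.91)-(1.92) p.91, (1.98) p.92, (1.101) p.93, p.98] -/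
theorem SLetτL_holds_member (L : ℕ) (hL : 1 < L) :
    ∃ (B₀'H B₂' BG BR : ℝ) (sx ρ₅ : ℕ), 0 < B₀'H ∧ 0 ≤ B₂' ∧ 0 ≤ BG ∧ 0 ≤ BR ∧
    ∀ (M' : ℕ), L ^ (sx + 1) ∣ M' →
    ∀ (F : T3Family), F.L = L → ∀ (n K : ℕ), n < K → ∀ (a : LSite (F.P K).d) (ρ' : ℕ), L ^ (sx + 1) ∣ ρ' → ρ₅ ≤ ρ' →
      ∃ (g Δ : (LSite (F.P K).d → (Matrix (Fin 2) (Fin 2) ℂ)) →ₗ[ℂ] (LSite (F.P K).d → (Matrix (Fin 2) (Fin 2) ℂ))) (q : (LSite (F.P K).d → (Matrix (Fin 2) (Fin 2) ℂ)) →ₗ[ℂ] (ℕ → LSite (F.P K).d → (Matrix (Fin 2) (Fin 2) ℂ)))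
      (qs : (ℕ → LSite (F.P K).d → (Matrix (Fin 2) (Fin 2) ℂ)) →ₗ[ℂ] (LSite (F.P K).d → (Matrix (Fin 2) (Fin 2) ℂ))) (Aw c : (ℕ → LSite (F.P K).d → (Matrix (Fin 2) (Fin 2) ℂ)) →ₗ[ℂ] (ℕ → LSite (F.P K).d → (Matrix (Fin 2) (Fin 2) ℂ)))
      (H' : XSpace (F.P K).d (K - n) (Matrix (Fin 2) (Fin 2) ℂ) →ₗ[ℂ] (LSite (F.P K).d → (Matrix (Fin 2) (Fin 2) ℂ))),
      (∀ x, ∀ y ∈ (cubeFam false (F.P K).L a M' ρ' (K - n)) 0, (Δ (g x) + qs (Aw (q (g x)))) y = x y) ∧ (∀ f, q (g (g (qs (c (q f))))) = q f) ∧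
      (∀ (f : LSite (F.P K).d → (Matrix (Fin 2) (Fin 2) ℂ)), ∀ x ∈ (cubeFam false (F.P K).L a M' ρ' (K - n)) 0, Δ f x = covLap (((F.L : ℝ)⁻¹) ^ (K - n)) (1 : LSite (F.P K).d → Fin (F.P K).d → (Matrix (Fin 2) (Fin 2) ℂ)ˣ) (((cubeFam false (F.P K).L a M' ρ' (K - n)) 0).indicator f) x) ∧
      (∀ (μ : ℕ → LSite (F.P K).d → (Matrix (Fin 2) (Fin 2) ℂ)), ∀ x ∈ (cubeFam false (F.P K).L a M' ρ' (K - n)) 0, qs μ x = QT (F.P K).L (K - n) (cubeLamS (F.P K).L a M' ρ' (K - n) (K - n)) (1 : LSite (F.P K).d → Fin (F.P K).d → (Matrix (Fin 2) (Fin 2) ℂ)ˣ) μ x) ∧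
      (∀ (f : LSite (F.P K).d → (Matrix (Fin 2) (Fin 2) ℂ)) (j : ℕ), j ≤ K - n → ∀ y ∈ (cubeLamS (F.P K).L a M' ρ' (K - n) (K - n)) j, q f j y = QprimeIter (zdBlocking (F.P K).d (F.P K).L) (bgT (F.P K).L (1 : LSite (F.P K).d → Fin (F.P K).d → (Matrix (Fin 2) (Fin 2) ℂ)ˣ)) j f y) ∧
      (∀ (X : XSpace (F.P K).d (K - n) (Matrix (Fin 2) (Fin 2) ℂ)) (x : LSite (F.P K).d), ‖H' X x‖ ≤ B₀'H * ‖X‖) ∧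
      (∀ j, j ≤ K - n → ∀ (X : XSpace (F.P K).d (K - n) (Matrix (Fin 2) (Fin 2) ℂ)), ∀ p ∈ {b : LSite (F.P K).d × Fin (F.P K).d | SideTouches ((cubeFam false (F.P K).L a M' ρ' (K - n)) j) b.1 b.2},
      wt (F.P K).L (((F.L : ℝ)⁻¹) ^ (K - n)) j * ‖covDerivFwd (((F.L : ℝ)⁻¹) ^ (K - n)) (1 : LSite (F.P K).d → Fin (F.P K).d → (Matrix (Fin 2) (Fin 2) ℂ)ˣ) p.2 (H' X) p.1‖ ≤ B₀'H * ‖X‖) ∧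
      (∀ X : XSpace (F.P K).d (K - n) (Matrix (Fin 2) (Fin 2) ℂ), Bd2 (F.P K).L (((F.L : ℝ)⁻¹) ^ (K - n)) (K - n) (cubeFam false (F.P K).L a M' ρ' (K - n)) (covLap (((F.L : ℝ)⁻¹) ^ (K - n)) (1 : LSite (F.P K).d → Fin (F.P K).d → (Matrix (Fin 2) (Fin 2) ℂ)ˣ) (H' X)) (B₂' * ‖X‖)) ∧
      (∀ (X : XSpace (F.P K).d (K - n) (Matrix (Fin 2) (Fin 2) ℂ)) (x : LSite (F.P K).d), x ∉ (cubeFam false (F.P K).L a M' ρ' (K - n)) 0 → H' X x = 0) ∧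
      (∀ X Y : XSpace (F.P K).d (K - n) (Matrix (Fin 2) (Fin 2) ℂ), (∀ p, Y p = -star (X p)) → ∀ x, H' Y x = -star (H' X x)) ∧
      (∀ (Y : XSpace (F.P K).d (K - n) (Matrix (Fin 2) (Fin 2) ℂ)) (j : ℕ) (hj : j ≤ K - n) (y : LSite (F.P K).d), y ∈ (cubeLamS (F.P K).L a M' ρ' (K - n) (K - n)) j →
      QprimeIter (zdBlocking (F.P K).d (F.P K).L) (bgT (F.P K).L (1 : LSite (F.P K).d → Fin (F.P K).d → (Matrix (Fin 2) (Fin 2) ℂ)ˣ)) j (H' Y) y = Y (⟨j, Nat.lt_succ_of_le hj⟩, y)) ∧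
      (∀ (f : LSite (F.P K).d → (Matrix (Fin 2) (Fin 2) ℂ)) (r : ℝ), 0 ≤ r → Bd2 (F.P K).L (((F.L : ℝ)⁻¹) ^ (K - n)) (K - n) (cubeFam false (F.P K).L a M' ρ' (K - n)) f r →
      (∀ x, ‖g f x‖ ≤ BG * r) ∧ ∀ j, j ≤ K - n → ∀ p ∈ {b : LSite (F.P K).d × Fin (F.P K).d | SideTouches ((cubeFam false (F.P K).L a M' ρ' (K - n)) j) b.1 b.2},
      wt (F.P K).L (((F.L : ℝ)⁻¹) ^ (K - n)) j * ‖covDerivFwd (((F.L : ℝ)⁻¹) ^ (K - n)) (1 : LSite (F.P K).d → Fin (F.P K).d → (Matrix (Fin 2) (Fin 2) ℂ)ˣ) p.2 (g f) p.1‖ ≤ BG * r) ∧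
      (∀ (f : LSite (F.P K).d → (Matrix (Fin 2) (Fin 2) ℂ)) (x : LSite (F.P K).d), x ∉ (cubeFam false (F.P K).L a M' ρ' (K - n)) 0 → g f x = 0) ∧
      (∀ f : LSite (F.P K).d → (Matrix (Fin 2) (Fin 2) ℂ), (∀ j, j ≤ K - n → ∀ x ∈ (cubeFam false (F.P K).L a M' ρ' (K - n)) j, IsSelfAdjoint (f x)) → ∀ x, IsSelfAdjoint (g f x)) ∧
      (∀ (f : LSite (F.P K).d → (Matrix (Fin 2) (Fin 2) ℂ)) (r : ℝ), 0 ≤ r → Bd2 (F.P K).L (((F.L : ℝ)⁻¹) ^ (K - n)) (K - n) (cubeFam false (F.P K).L a M' ρ' (K - n)) f r → Bd2 (F.P K).L (((F.L : ℝ)⁻¹) ^ (K - n)) (K - n) (cubeFam false (F.P K).L a M' ρ' (K - n)) (f - g (qs (c (q (g f))))) (BR * r)) ∧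
      (∀ f : LSite (F.P K).d → (Matrix (Fin 2) (Fin 2) ℂ), (∀ j, j ≤ K - n → ∀ x ∈ (cubeFam false (F.P K).L a M' ρ' (K - n)) j, IsSelfAdjoint (f x)) → ∀ j, j ≤ K - n → ∀ x ∈ (cubeFam false (F.P K).L a M' ρ' (K - n)) j, IsSelfAdjoint ((f - g (qs (c (q (g f))))) x)) ∧
      (∀ X : XSpace (F.P K).d (K - n) (Matrix (Fin 2) (Fin 2) ℂ), (∀ p, trCLM (Fin 2) (X p) = 0) → ∀ x, trCLM (Fin 2) (H' X x) = 0) ∧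
      (∀ f : LSite (F.P K).d → (Matrix (Fin 2) (Fin 2) ℂ), (∀ j, j ≤ K - n → ∀ x ∈ (cubeFam false (F.P K).L a M' ρ' (K - n)) j, trCLM (Fin 2) (f x) = 0) → ∀ x, trCLM (Fin 2) (g f x) = 0) ∧
      (∀ f : LSite (F.P K).d → (Matrix (Fin 2) (Fin 2) ℂ), (∀ j, j ≤ K - n → ∀ x ∈ (cubeFam false (F.P K).L a M' ρ' (K - n)) j, trCLM (Fin 2) (f x) = 0) → ∀ j, j ≤ K - n → ∀ x ∈ (cubeFam false (F.P K).L a M' ρ' (K - n)) j, trCLM (Fin 2) ((f - g (qs (c (q (g f))))) x) = 0) := by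
  obtain ⟨B₀'H, B₂', BG, BR, sx, ρ₅, hB₀'H, hB₂', hBG, hBR, H⟩ := SLetτAllL_holds_member L hL
  refine ⟨B₀'H, B₂', BG, BR, sx, ρ₅, hB₀'H, hB₂', hBG, hBR, ?_⟩
  intro M' hdM F hF n K hnK a ρ' hdρ hρ₅
  exact H F hF n K hnK a M' ρ' hdM hdρ hρ₅ (K - n) (by omega) le_rfl

end T3

end Summit.QuantumFields.YangMills.Theorems.HalvingSLetTauFlatCubeMember

end
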